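import Summits.BirchSwinnertonDyer.BirchSwinnertonDyer.Theorems.BiquadraticEisensteinDescentSymbolicMonskyDefs
import Summits.BirchSwinnertonDyer.BirchSwinnertonDyer.Theorems.BiquadraticEisensteinDescentHeegnerTwistCouplingInSupplyMonskyCells
import HarnessLib

set_option linter.dupNamespace false -- `Summit.BirchSwinnertonDyer.BirchSwinnertonDyer.Theorems.…` (summit = sub)
set_option autoImplicit false

/-!
# Crux `HeegnerTwistCouplingInSupply` (stmt-BirchSwinnertonDyer-21381), card `sign-table-character-dichotomy`:
# the symbolic Monsky engine is SOUND — `detCheckOdd/Even d = true ⟹ det (monskyOddS/EvenS d) = 1` over `𝔽₂`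

Cell `pub/bsd-wall`, width-prover seat `bsd-wall-cm-bed-w3` g18; companion of `BiquadraticEisensteinDescentSymbolicMonskyDefs.lean`
(the definitions). Content (all elementary, [folklore]):
* §1 `𝔽₂` bookkeeping: sums of `bz`-values along lists / `Fin m` are `bz` of XOR-folds (`sum_map_bz`, `sum_fin_bz`,
  `sum_univ_bz`); bits of `ofBits`; bit `j` of the selected XOR of rows `xorSelFrom` (= row `m · N` over `𝔽₂`); unpacking of
  the row-by-row check `mulRowsCheckFrom`.
* §2 **Soundness of the verified product check**: `mulRowsCheck R N = true ⟹ matOfRows m R * matOfRows m N = 1 ⟹ det = 1`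
  (`det M · det N = 1` forces `det M = 1` in `𝔽₂`); hence `detCheckRows R = true ⟹ det (matOfRows |R| R) = 1` — WHATEVER the
  unverified Gauss–Jordan oracle returned.
* §3 The bitmask rows `rowsOdd/rowsEven d` ARE the symbolic matrices reindexed along `finSumFinEquiv : Fin k ⊕ Fin k ≃ Fin (k+k)`
  (`matOfRows_rowsOdd/Even`), so **`detCheckOdd d = true ⟹ det d.monskyOddS = 1`** and the even twin.

THEOREMS ONLY; nothing about Selmer groups, `L`-values, the crux or BSD is asserted. Supports stmt-BirchSwinnertonDyer-21381.
-/

namespace Summit.BirchSwinnertonDyer.BirchSwinnertonDyer.Theorems.SymbolicMonsky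

open Matrix Literature.NumberTheory.EllipticCurves Literature.NumberTheory.EllipticCurves.HeathBrown1994
  Literature.NumberTheory.EllipticCurves.HeathBrown1994.Families
open Summit.BirchSwinnertonDyer.BirchSwinnertonDyer.Theorems.BiquadraticEisensteinDescentHeegnerTwistCouplingInSupplyMonskyCells
  (det_eq_one_of_mul_eq_one)

/-! ## §1–§2 `𝔽₂` bookkeeping and soundness of the verified product check -/

section Generic

variable {α : Type*}

/-- `bz` is additive for XOR (`1 + 1 = 0` in `𝔽₂`). (Private: a textually identical statement about an unrelated `bz`
exists in `Literature/Computability`.) -/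
private theorem bz_xor (a b : Bool) : bz (xor a b) = bz a + bz b := by
  cases a <;> cases b <;> decide

/-- `bz` is multiplicative for AND. -/
theorem bz_and_mul (a b : Bool) : bz a * bz b = bz (a && b) := by
  cases a <;> cases b <;> decide

/-- `bz (decide p && b)` as an `if`. -/
theorem bz_decide_and (p : Prop) [Decidable p] (b : Bool) : bz (decide p && b) = if p then bz b else 0 := by
  by_cases hp : p <;> simp [hp, bz]

/-- XOR-fold of the empty list. -/
theorem xorFold_nil (f : α → Bool) : xorFold [] f = false := rfl

/-- XOR-fold of a cons. -/
theorem xorFold_cons (a : α) (L : List α) (f : α → Bool) :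
    xorFold (a :: L) f = xor (f a) (xorFold L f) := rfl

/-- XOR-fold of an append. -/
theorem xorFold_append (L M : List α) (f : α → Bool) :
    xorFold (L ++ M) f = xor (xorFold L f) (xorFold M f) := by
  induction L with
  | nil => simp [xorFold]
  | cons a L ih => rw [List.cons_append, xorFold_cons, xorFold_cons, ih, Bool.xor_assoc]

/-- XOR-fold of a mapped list. -/
theorem xorFold_map {β : Type*} (L : List β) (g : β → α) (f : α → Bool) :
    xorFold (L.map g) f = xorFold L (f ∘ g) := by
  induction L with
  | nil => rfl
  | cons a L ih => rw [List.map_cons, xorFold_cons, xorFold_cons, ih]; rfl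

/-- XOR-fold of a filtered list = XOR-fold of the guarded function. -/
theorem xorFold_filter (L : List α) (p : α → Bool) (f : α → Bool) :
    xorFold (L.filter p) f = xorFold L (fun a => p a && f a) := by
  induction L with
  | nil => rfl
  | cons a L ih =>
    rw [List.filter_cons, xorFold_cons]
    cases hp : p a
    · simp [ih]
    · simp [xorFold_cons, ih]

/-- XOR-fold only depends on the values on the list. -/
theorem xorFold_congr (L : List α) {f g : α → Bool} (h : ∀ a ∈ L, f a = g a) : xorFold L f = xorFold L g := by
  induction L with
  | nil => rfl
  | cons a L ih =>
    rw [xorFold_cons, xorFold_cons, h a (by simp), ih (fun b hb => h b (by simp [hb]))]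

/-- Sum of `𝔽₂`-values of bits along a list = the value of their XOR. [folklore] -/
theorem sum_map_bz (L : List α) (f : α → Bool) : (L.map fun a => bz (f a)).sum = bz (xorFold L f) := by
  induction L with
  | nil => rfl
  | cons a L ih => rw [List.map_cons, List.sum_cons, ih, xorFold_cons, bz_xor]

/-- Sum over `Fin m` of `𝔽₂`-values of bits = XOR along `List.range m`. [folklore] -/
theorem sum_fin_bz (m : ℕ) (g : ℕ → Bool) : ∑ l : Fin m, bz (g l) = bz (xorFold (List.range m) g) := by
  induction m with
  | zero => rfl
  | succ m ih =>
    rw [Fin.sum_univ_castSucc, List.range_succ, xorFold_append, bz_xor]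
    simp only [Fin.val_castSucc, Fin.val_last, ih, xorFold_cons, xorFold_nil, Bool.xor_false]

/-- Sum over `Fin k` (as a type) = XOR along `List.finRange k`. [folklore] -/
theorem sum_univ_bz (k : ℕ) (g : Fin k → Bool) : ∑ l : Fin k, bz (g l) = bz (xorFold (List.finRange k) g) := by
  rw [Fin.sum_univ_def, sum_map_bz]

/-- The bits of `ofBits bs` are `bs`. -/
theorem testBit_ofBits (bs : List Bool) (n : ℕ) : (ofBits bs).testBit n = bs.getD n false := by
  induction bs generalizing n with
  | nil => simp [ofBits]
  | cons b bs ih =>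
    cases n with
    | zero => simp [ofBits]
    | succ n => simp [ofBits, Nat.testBit_bit_succ, ih]

/-- Bit `j` of the selected XOR of rows = XOR over the rows of (selector bit AND row bit): row `m · N` over `𝔽₂`. -/
theorem testBit_xorSelFrom (m : ℕ) (N : List ℕ) (l₀ j : ℕ) :
    (xorSelFrom m l₀ N).testBit j =
      xorFold (List.range N.length) (fun l => m.testBit (l₀ + l) && (N.getD l 0).testBit j) := by
  induction N generalizing l₀ with
  | nil => simp [xorSelFrom, xorFold_nil]
  | cons r rs ih =>
    rw [xorSelFrom, Nat.testBit_xor, ih (l₀ + 1), List.length_cons, List.range_succ_eq_map, xorFold_cons,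
      xorFold_map]
    congr 1
    · cases m.testBit l₀ <;> simp
    · exact xorFold_congr _ fun l _ => by simp [Function.comp, Nat.add_assoc, Nat.add_comm 1 l]

/-- Unpacking of the row-by-row product check: row `n` of `R · N` is the unit row `2 ^ (i + n)`. -/
theorem mulRowsCheckFrom_spec (N : List ℕ) (R : List ℕ) (i : ℕ) (h : mulRowsCheckFrom N i R = true)
    (n : ℕ) (hn : n < R.length) : xorSelFrom (R.getD n 0) 0 N = 2 ^ (i + n) := by
  induction R generalizing i n with
  | nil => simp at hn
  | cons r rs ih =>
    simp only [mulRowsCheckFrom, Bool.and_eq_true, beq_iff_eq] at h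
    cases n with
    | zero => simpa using h.1
    | succ n =>
      have := ih (i + 1) h.2 n (by simpa using hn)
      simpa [Nat.add_assoc, Nat.add_comm 1 n] using this


/-- Entries of a product of bitmask-row matrices as XOR-folds. -/
theorem matOfRows_mul_apply (m : ℕ) (R N : List ℕ) (i j : Fin m) :
    (matOfRows m R * matOfRows m N) i j =
      bz (xorFold (List.range m) fun l => (R.getD i 0).testBit l && (N.getD l 0).testBit j) := by
  rw [Matrix.mul_apply]
  simp only [matOfRows, Matrix.of_apply, bz_and_mul]
  exact sum_fin_bz m (fun l => (R.getD i 0).testBit l && (N.getD l 0).testBit j)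

/-- **Soundness of the verified product check**: if `mulRowsCheck R N` accepts, the `𝔽₂` matrix with rows `R` is
invertible, `det = 1`. [folklore] -/
theorem det_matOfRows_eq_one_of_mulRowsCheck {m : ℕ} (R N : List ℕ) (hR : R.length = m)
    (h : mulRowsCheck R N = true) : (matOfRows m R).det = 1 := by
  simp only [mulRowsCheck, Bool.and_eq_true, beq_iff_eq] at h
  obtain ⟨hN, h⟩ := h
  refine det_eq_one_of_mul_eq_one _ (matOfRows m N) ?_
  ext i j
  rw [matOfRows_mul_apply, Matrix.one_apply]
  have hx := mulRowsCheckFrom_spec N R 0 h i (by omega)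
  have key : (xorFold (List.range m) fun l => (R.getD i 0).testBit l && (N.getD l 0).testBit j) =
      decide (i = j) := by
    have := testBit_xorSelFrom (R.getD i 0) N 0 j
    rw [hx, Nat.zero_add, Nat.testBit_two_pow, hN, hR] at this
    simp only [Nat.zero_add] at this
    rw [← this]
    by_cases hij : i = j
    · simp [hij]
    · simp [hij, Fin.val_eq_val]
  rw [key]
  by_cases hij : i = j <;> simp [hij, bz]

/-- **Soundness of `detCheckRows`.** [folklore] -/
theorem det_matOfRows_eq_one_of_detCheckRows {m : ℕ} (R : List ℕ) (hR : R.length = m)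
    (h : detCheckRows R = true) : (matOfRows m R).det = 1 :=
  det_matOfRows_eq_one_of_mulRowsCheck R _ hR h

end Generic

/-! ## §3 The symbolic matrices have `det = 1` when the check accepts -/

namespace SymbData

variable {k : ℕ} (d : SymbData k)

/-- `idxList k` has length `2k`. -/
theorem idxList_length : (idxList k).length = k + k := by
  simp [idxList]

/-- The `n`-th element of `idxList k` is `finSumFinEquiv.symm n`. -/
theorem getElem?_idxList (i : Fin (k + k)) : (idxList k)[i.val]? = some (finSumFinEquiv.symm i) := by
  obtain ⟨n, hn⟩ := i
  by_cases h : n < k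
  · have h1 : n < ((List.finRange k).map (Sum.inl : Fin k → Fin k ⊕ Fin k)).length := by simpa using h
    have hs : finSumFinEquiv.symm (⟨n, hn⟩ : Fin (k + k)) = Sum.inl (⟨n, h⟩ : Fin k) :=
      finSumFinEquiv_symm_apply_castAdd (n := k) ⟨n, h⟩
    rw [hs, idxList, List.getElem?_append_left h1, List.getElem?_map,
      List.getElem?_eq_getElem (by simpa using h), List.getElem_finRange]
    simp
  · have h1 : ((List.finRange k).map (Sum.inl : Fin k → Fin k ⊕ Fin k)).length ≤ n := by simpa using h
    have h2 : n - k < k := by omega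
    have hs : finSumFinEquiv.symm (⟨n, hn⟩ : Fin (k + k)) = Sum.inr (⟨n - k, h2⟩ : Fin k) := by
      have : (⟨n, hn⟩ : Fin (k + k)) = Fin.natAdd k ⟨n - k, h2⟩ := Fin.ext (by simp; omega)
      rw [this]
      exact finSumFinEquiv_symm_apply_natAdd (m := k) ⟨n - k, h2⟩
    rw [hs, idxList, List.getElem?_append_right h1, List.getElem?_map, List.length_map, List.length_finRange,
      List.getElem?_eq_getElem (by simpa using h2), List.getElem_finRange]
    simp

/-- Looking up position `i` in a list indexed by `idxList k`. -/
theorem getD_map_idxList {β : Type*} (F : Fin k ⊕ Fin k → β) (i : Fin (k + k)) (dflt : β) :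
    ((idxList k).map F).getD i.val dflt = F (finSumFinEquiv.symm i) := by
  rw [List.getD_eq_getElem?_getD, List.getElem?_map, getElem?_idxList]
  simp

/-- The bits of `ofBits bs` are `bs`. -/
theorem testBit_ofBits_map (f : Fin k ⊕ Fin k → Bool) (j : Fin (k + k)) :
    (ofBits ((idxList k).map f)).testBit j.val = f (finSumFinEquiv.symm j) := by
  rw [testBit_ofBits, getD_map_idxList]

/-- The odd symbolic matrix has `2k` bitmask rows. -/
theorem rowsOdd_length : d.rowsOdd.length = k + k := by
  simp [rowsOdd, idxList_length]

/-- The even symbolic matrix has `2k` bitmask rows. -/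
theorem rowsEven_length : d.rowsEven.length = k + k := by
  simp [rowsEven, idxList_length]

/-- The bitmask rows of the odd symbolic matrix ARE that matrix (reindexed to `Fin (k + k)`). -/
theorem matOfRows_rowsOdd :
    matOfRows (k + k) d.rowsOdd = Matrix.reindex finSumFinEquiv finSumFinEquiv d.monskyOddS := by
  ext i j
  simp only [matOfRows, Matrix.of_apply, Matrix.reindex_apply, Matrix.submatrix_apply, monskyOddS]
  rw [rowsOdd, getD_map_idxList, testBit_ofBits_map]

/-- The bitmask rows of the even symbolic matrix ARE that matrix (reindexed to `Fin (k + k)`). -/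
theorem matOfRows_rowsEven :
    matOfRows (k + k) d.rowsEven = Matrix.reindex finSumFinEquiv finSumFinEquiv d.monskyEvenS := by
  ext i j
  simp only [matOfRows, Matrix.of_apply, Matrix.reindex_apply, Matrix.submatrix_apply, monskyEvenS]
  rw [rowsEven, getD_map_idxList, testBit_ofBits_map]

/-- **`detCheckOdd` is sound**: the symbolic odd Monsky matrix is invertible over `𝔽₂`. [folklore] -/
theorem det_monskyOddS_eq_one (h : d.detCheckOdd = true) : d.monskyOddS.det = 1 := by
  have := det_matOfRows_eq_one_of_detCheckRows d.rowsOdd d.rowsOdd_length h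
  rwa [matOfRows_rowsOdd, Matrix.det_reindex_self] at this

/-- **`detCheckEven` is sound**: the symbolic even Monsky matrix is invertible over `𝔽₂`. [folklore] -/
theorem det_monskyEvenS_eq_one (h : d.detCheckEven = true) : d.monskyEvenS.det = 1 := by
  have := det_matOfRows_eq_one_of_detCheckRows d.rowsEven d.rowsEven_length h
  rwa [matOfRows_rowsEven, Matrix.det_reindex_self] at this

end SymbData

end Summit.BirchSwinnertonDyer.BirchSwinnertonDyer.Theorems.SymbolicMonsky
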